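import Summits.QuantumFields.BalabanUV.T4Continuum.Support.VariationalVectorInterpolant
import Summits.QuantumFields.BalabanUV.T4Continuum.Support.VariationalAssemblySlice

/-!
# T⁴ programme, spine node NE2 (U1a), lane P2 — THE COMPOSITE-FIBRE DEFECT OF THE COMPONENTWISE CENTRED INTERPOLANT `J_c` under the frame-adapted carriers
# (item «V-ONE-G WITH BACKGROUND», file 4c; model level; cell `pub-balaban`)

NE2 formalisation swarm `b2b-balaban-t4-ne2-formalise-*`, leaf prover 01 GEN 8 (`prover-b2b-balaban-t4-ne2-formalise-leaf-01-g8-0`); journal INTENT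
CLAIMS.log 2026-08-20 l.18200 ∕ l.19154.  File 1's `hONEm_of_curl_oneG_repair` takes a competitor map that MISSES the composite fibre by a small unit datum;
this file measures the miss for `J_c W := (x,ν) ↦ interpv U′ Rc (W(·,ν)) x` against V-ONE-1F's frame-adapted one-step carriers `frameT U′ Rc` (leaf-01-g6).

MECHANISM (no telescoping needed).  `J_c W = interpV U′ Rc W − corr W` EXACTLY, where V-ONE-1F's tilted interpolant `interpV` meets the one-step constraint
exactly (`QvL_interpV`) and the correction is the tilt itself, `corr W x ν = U′(x)⋆((lt_L − wt_L)(j_ν)•(D_νW_ν)(y))` — a field of FIRST differences with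
`|lt − wt| ≤ 5∕2` (`abs_lt_sub_wt_le`).  Hence `Q₁(J_cW) = W − Q₁(corr W)` and for ANY contractive coarse line transports `T_k`:
    `nsqV (Q_k W − Q_k(Q₁(J_cW))) = nsqV (Q_k(Q₁(corr W))) ≤ qWV (Q₁ (corr W)) ≤ qVV (corr W) ≤ (25∕4)·(n^d)⁻¹·Σ_{y,ν}‖(D_νW_ν)(y)‖²`
(`nsqV_QvL_le_qWV`, `qWV_QvL_le_qVV`) — i.e. `(25∕4)·n⁻²` times the PHYSICAL diagonal rough form `(n^d)⁻¹n²·Σ‖D_νW_ν‖²`: decaying like `L^{−2k}` against a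
V-REG ∕ (GF3)-controlled size (memo VONEG §2: the measured defect is second order at flat frames, first order with taxi frames — both inside this bound's rate).
 * §1 `corrV_eq` (the exact decomposition), `nsqV_corrV_le` (its size);
 * §2 **`fibreDefect_centred_le`**: the displayed `hJdef`-type input of the repair, in the derivative currency.

HONEST FRAMING (T4-DAG p. 1).  Lattice bookkeeping at MODEL level (frames ∕ bond operators ∕ line transports DATA, c5); [folklore]; nothing printed is a
hypothesis; no `def`, no `def … : Prop`, no `sorry`; axioms standard.  (ONE-min) ∕ V-END with background ∕ NE2 NOT proved here; NE3 OPEN; spine PROVED 0∕9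
unchanged; rung (B)+1 on a fixed finite T⁴ — NOT infinite volume, NOT mass gap, NOT Clay.  HONEST DEPENDENCY (cell, verbatim): continuum YM on T⁴ ⇐ BetaPertH ∧
nine spine estimates (0/9 proved); BetaPertH ⇐ (D1) ∧ (D4) ∧ CAP+tail; G-an2-4 gates asym, D1 and NE2/3/4.
-/

noncomputable section

namespace Summit.QuantumFields.BalabanUV.T4Continuum.VariationalVectorCentredFibre

open Finset
open Literature.MathematicalPhysics.QuantumFieldTheory.Balaban1983to89
open Literature.MathematicalPhysics.QuantumFieldTheory.Balaban1983to89.B5Prop11Plancherel (Tor fine unitVec)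
open Literature.MathematicalPhysics.QuantumFieldTheory.Balaban1983to89.B5Block118 (bpt)
open Literature.MathematicalPhysics.QuantumFieldTheory.Balaban1983to89.B5Blocks16 (blockOf blockOf_bpt)
open Literature.MathematicalPhysics.QuantumFieldTheory.Balaban1983to89.B5AverageCurlStokes (sum_blocks_real)
open Summit.QuantumFields.BalabanUV.T4Continuum.ScalarBlockTrialFunction (digits digits_bpt)
open Summit.QuantumFields.BalabanUV.T4Continuum.VariationalColourFederbush (cDv norm_le_one_of_mem_unitary)
open Summit.QuantumFields.BalabanUV.T4Continuum.VariationalCovariantWeights (wt)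
open Summit.QuantumFields.BalabanUV.T4Continuum.VariationalColourInterpolant (Phiv PhiFv interpv norm_star_apply_le)
open Summit.QuantumFields.BalabanUV.T4Continuum.VariationalVectorInterpolant (lt PhiV PhiFV interpV frameT abs_lt_sub_wt_le QvL_interpV)
open Summit.QuantumFields.BalabanUV.T4Continuum.VectorBlockTrialForm (QvL nsqV nsqV_nonneg)
open Summit.QuantumFields.BalabanUV.T4Continuum.VariationalVectorForm (qWV qVV)
open Summit.QuantumFields.BalabanUV.T4Continuum.VariationalVectorAverage (nsqV_QvL_le_qWV)
open Summit.QuantumFields.BalabanUV.T4Continuum.VariationalAssemblySlice (qWV_QvL_le_qVV)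

variable {d : ℕ} {E : Type*} [NormedAddCommGroup E] [InnerProductSpace ℂ E] [CompleteSpace E]

/-! ## §1 `J_c = interpV − corr` and the size of the correction -/

section Corr

variable (L : ℕ) [NeZero L] (N : Fin d → ℕ) [∀ μ, NeZero (N μ)] (U' : Tor (fine L N) → (E →L[ℂ] E)) (Rc : Tor N → Fin d → (E →L[ℂ] E))
  (W : Tor N → Fin d → E)

/-- **THE COMPONENTWISE CENTRED INTERPOLANT IS V-ONE-1F's TILTED ONE MINUS THE TILT**:
`interpv U′ Rc (W(·,ν)) x = interpV U′ Rc W x ν − U′(x)⋆((lt − wt)(j_ν)•(D_νW_ν)(y))`. [folklore] -/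
theorem corrV_eq (x : Tor (fine L N)) (ν : Fin d) :
    interpv L N U' Rc (fun z => W z ν) x
      = interpV L N U' Rc W x ν
        - star (U' x) ((((lt L (digits L N x ν) - wt L (digits L N x ν)) : ℝ) : ℂ) • cDv N Rc (fun z => W z ν) (blockOf L N x) ν) := by
  simp only [interpv, PhiFv, interpV, PhiFV, PhiV, map_add, add_sub_cancel_right]

omit [NeZero L] in
/-- the size of the tilt field: `Σ_{x,ν}‖U′(x)⋆((lt − wt)(j_ν)•(D_νW_ν)(y))‖² ≤ (25∕4)·L^d·Σ_{y,ν}‖(D_νW_ν)(y)‖²` (unitary frames, `|lt − wt| ≤ 5∕2`). [folklore] -/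
theorem nsqV_corrV_le [NeZero L] (hU : ∀ x, U' x ∈ unitary (E →L[ℂ] E)) :
    nsqV (fine L N) (fun x ν => star (U' x) ((((lt L (digits L N x ν) - wt L (digits L N x ν)) : ℝ) : ℂ) • cDv N Rc (fun z => W z ν) (blockOf L N x) ν))
      ≤ 25 / 4 * ((L : ℝ) ^ d * ∑ y, ∑ ν, ‖cDv N Rc (fun z => W z ν) y ν‖ ^ 2) := by
  have hcardR : (Fintype.card (Fin d → Fin L) : ℝ) = (L : ℝ) ^ d := by
    rw [Fintype.card_fun, Fintype.card_fin, Fintype.card_fin]; push_cast; ring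
  have hpt : ∀ (x : Tor (fine L N)) (ν : Fin d),
      ‖star (U' x) ((((lt L (digits L N x ν) - wt L (digits L N x ν)) : ℝ) : ℂ) • cDv N Rc (fun z => W z ν) (blockOf L N x) ν)‖ ^ 2
        ≤ 25 / 4 * ‖cDv N Rc (fun z => W z ν) (blockOf L N x) ν‖ ^ 2 := by
    intro x ν
    have h1 := norm_star_apply_le (hU x) ((((lt L (digits L N x ν) - wt L (digits L N x ν)) : ℝ) : ℂ) • cDv N Rc (fun z => W z ν) (blockOf L N x) ν)
    rw [norm_smul, Complex.norm_real, Real.norm_eq_abs] at h1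
    have h2 : |lt L (digits L N x ν) - wt L (digits L N x ν)| ≤ 5 / 2 := abs_lt_sub_wt_le L (digits L N x ν).is_lt
    have h3 : ‖star (U' x) ((((lt L (digits L N x ν) - wt L (digits L N x ν)) : ℝ) : ℂ) • cDv N Rc (fun z => W z ν) (blockOf L N x) ν)‖
        ≤ 5 / 2 * ‖cDv N Rc (fun z => W z ν) (blockOf L N x) ν‖ :=
      h1.trans (mul_le_mul_of_nonneg_right h2 (norm_nonneg _))
    have h0 : 0 ≤ 5 / 2 * ‖cDv N Rc (fun z => W z ν) (blockOf L N x) ν‖ := by positivity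
    nlinarith [pow_le_pow_left₀ (norm_nonneg _) h3 2]
  unfold nsqV
  calc ∑ x, ∑ ν, ‖star (U' x) ((((lt L (digits L N x ν) - wt L (digits L N x ν)) : ℝ) : ℂ) • cDv N Rc (fun z => W z ν) (blockOf L N x) ν)‖ ^ 2
      ≤ ∑ x, ∑ ν, 25 / 4 * ‖cDv N Rc (fun z => W z ν) (blockOf L N x) ν‖ ^ 2 := Finset.sum_le_sum fun x _ => Finset.sum_le_sum fun ν _ => hpt x ν
    _ = 25 / 4 * ((L : ℝ) ^ d * ∑ y, ∑ ν, ‖cDv N Rc (fun z => W z ν) y ν‖ ^ 2) := by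
        rw [sum_blocks_real L N (fun x => ∑ ν, 25 / 4 * ‖cDv N Rc (fun z => W z ν) (blockOf L N x) ν‖ ^ 2)]
        simp only [blockOf_bpt, Finset.sum_const, Finset.card_univ, nsmul_eq_mul, hcardR]
        rw [Finset.mul_sum, Finset.mul_sum]
        refine Finset.sum_congr rfl fun y _ => ?_
        rw [Finset.mul_sum, Finset.mul_sum, Finset.mul_sum]
        refine Finset.sum_congr rfl fun ν _ => ?_
        ring

end Corr

/-! ## §2 The composite-fibre defect -/

section Fibre

variable (n L : ℕ) [NeZero n] [NeZero L] (M : Fin d → ℕ) [hM : ∀ μ, NeZero (M μ)]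

/-- **THE COMPOSITE-FIBRE DEFECT OF `J_c`** (frame-adapted one-step carriers `frameT U′ Rc` with unitary frames `U′` and unitary coarse `Rc`; ANY contractive coarse
line transports `T_k`): `nsqV (Q_k W − Q_k(Q₁(J_cW))) ≤ (25∕4)·(n^d)⁻¹·Σ_{y,ν}‖(D_νW_ν)(y)‖²` — `(25∕4)n⁻²` times the physical diagonal rough form. [folklore] -/
theorem fibreDefect_centred_le {Tk : Tor M → (Fin d → Fin n) → Fin n → Fin d → (E →L[ℂ] E)} (hTk : ∀ y j t μ, ‖Tk y j t μ‖ ≤ 1)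
    {U' : Tor (fine L (fine n M)) → (E →L[ℂ] E)} (hU : ∀ x, U' x ∈ unitary (E →L[ℂ] E)) {Rc : Tor (fine n M) → Fin d → (E →L[ℂ] E)}
    (hRc : ∀ y μ, Rc y μ ∈ unitary (E →L[ℂ] E)) (W : Tor (fine n M) → Fin d → E) :
    nsqV M (QvL n M Tk W - QvL n M Tk (QvL L (fine n M) (frameT L (fine n M) U' Rc) (fun x ν => interpv L (fine n M) U' Rc (fun z => W z ν) x)))
      ≤ 25 / 4 * (((n : ℝ) ^ d)⁻¹ * ∑ y, ∑ ν, ‖cDv (fine n M) Rc (fun z => W z ν) y ν‖ ^ 2) := by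
  have hn : (0 : ℝ) < n := by exact_mod_cast Nat.pos_of_ne_zero (NeZero.ne n)
  have hL : (0 : ℝ) < L := by exact_mod_cast Nat.pos_of_ne_zero (NeZero.ne L)
  set corr : Tor (fine L (fine n M)) → Fin d → E := fun x ν =>
    star (U' x) ((((lt L (digits L (fine n M) x ν) - wt L (digits L (fine n M) x ν)) : ℝ) : ℂ) • cDv (fine n M) Rc (fun z => W z ν) (blockOf L (fine n M) x) ν) with hcorr
  -- `J_c W = interpV W − corr`
  have hJ : (fun x ν => interpv L (fine n M) U' Rc (fun z => W z ν) x) = interpV L (fine n M) U' Rc W - corr := by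
    funext x ν
    rw [Pi.sub_apply, Pi.sub_apply, hcorr, corrV_eq]
  have hQsub : ∀ {P : Fin d → ℕ} [∀ μ, NeZero (P μ)] (m' : ℕ) [NeZero m'] (T : Tor P → (Fin d → Fin m') → Fin m' → Fin d → (E →L[ℂ] E))
      (A B : Tor (fine m' P) → Fin d → E), QvL m' P T (A - B) = QvL m' P T A - QvL m' P T B := by
    intro P _ m' _ T A B
    funext y μ
    simp only [QvL, Pi.sub_apply, map_sub, Finset.sum_sub_distrib, smul_sub]
  -- `Q₁(J_c W) = W − Q₁ corr`
  have hQ1 : QvL L (fine n M) (frameT L (fine n M) U' Rc) (fun x ν => interpv L (fine n M) U' Rc (fun z => W z ν) x)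
      = W - QvL L (fine n M) (frameT L (fine n M) U' Rc) corr := by
    rw [hJ, hQsub, QvL_interpV L (fine n M) Rc W hU]
  -- the frame-adapted carriers are contractive
  have hfr : ∀ y j t μ, ‖frameT L (fine n M) U' Rc y j t μ‖ ≤ 1 := by
    intro y j t μ
    unfold frameT
    split_ifs
    · exact norm_le_one_of_mem_unitary (hU _)
    · exact (norm_mul_le _ _).trans (by
        have h1 := norm_le_one_of_mem_unitary (hRc y μ)
        have h2 := norm_le_one_of_mem_unitary (hU (bpt L (fine n M) y j + B5Block118.tstep (fine L (fine n M)) μ t))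
        nlinarith [norm_nonneg (Rc y μ), norm_nonneg (U' (bpt L (fine n M) y j + B5Block118.tstep (fine L (fine n M)) μ t))])
  -- `Q_k W − Q_k (W − Q₁ corr) = Q_k (Q₁ corr)`
  rw [hQ1, ← hQsub, sub_sub_cancel]
  calc nsqV M (QvL n M Tk (QvL L (fine n M) (frameT L (fine n M) U' Rc) corr))
      ≤ qWV n M (QvL L (fine n M) (frameT L (fine n M) U' Rc) corr) := nsqV_QvL_le_qWV n M hTk _
    _ ≤ qVV n L M corr := qWV_QvL_le_qVV n L M hfr corr
    _ ≤ _ := by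
        unfold qVV
        have h := nsqV_corrV_le L (fine n M) U' Rc W hU
        rw [mul_pow]
        calc (((n : ℝ) ^ d * (L : ℝ) ^ d))⁻¹ * nsqV (fine L (fine n M)) corr
            ≤ (((n : ℝ) ^ d * (L : ℝ) ^ d))⁻¹ * (25 / 4 * ((L : ℝ) ^ d * ∑ y, ∑ ν, ‖cDv (fine n M) Rc (fun z => W z ν) y ν‖ ^ 2)) :=
              mul_le_mul_of_nonneg_left h (by positivity)
          _ = _ := by field_simp

end Fibre

end Summit.QuantumFields.BalabanUV.T4Continuum.VariationalVectorCentredFibre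

end
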